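import Literature.NumberTheory.EllipticCurves.ProfiniteGroupDistributionMomentsPushforward
import Literature.GroupTheory.Abelian.MonoidHomSpanFunctions
import HarnessLib

/-!
# A group distribution killed by every `χ · (ρ⁻¹)^m`, `m ≥ m₀` (`χ` a character of a finite level trivial on a
# marked subgroup `I`, `ρ` a `ℤ_pˣ`-valued character separating `I` along the tower) is ZERO — proofs only

Topic `NumberTheory/EllipticCurves` (siblings `ProfiniteGroupDistributionMomentsPushforward`,
`PAdicMeasureMomentsDetermineUnits`; `GroupTheory/Abelian/MonoidHomSpanFunctions`). PROOFS ONLY (no definition,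
no named fact, no `sorry`, no instance).

★★★ `GroupDistribution.μ_eq_zero_of_forall_integral_char_mul_inv_pow`. SETTING: `G` a group with a tower `𝒰`
of normal finite-index subgroups such that every `G ⧸ U_n` is abelian (`hcomm`); `ρ : G →* ℤ_pˣ` with
`ρ ≡ 1 mod p^{n+1}` on `U_n` (`hρU`); a subgroup `I ≤ G` SEPARATED by `ρ` along the tower
(`hI : i ∈ I, ρ(i) ≡ 1 mod p^{n+1} ⇒ i ∈ U_n`); a `ℂ_p`-valued bounded distribution `ν` on `G` along `𝒰` with
`∫ χ·(ρ⁻¹)^m dν = 0` for every `m ≥ m₀` and every character `χ : G →* ℂ_p` trivial on some `U_n` and on `I`.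
CONCLUSION: `ν = 0` (every level datum vanishes).

PROOF (finite Fourier inversion + the units brick): fix a cell `gU_n`; `N := U_n ⊔ I` is normal with finite
abelian quotient `Q = G ⧸ N`; (a) `σ ∈ gU_n ⟺ σ ∈ gN ∧ ρ(σ) ≡ ρ(g) mod p^{n+1}` (`hρU`, `hI`, `N = U_n·I`);
(b) the indicator of `ḡ ∈ Q` is a `ℂ_p`-combination of the characters of `Q`
(`CharacterSpan.exists_sum_smul_monoidHom_padicComplex_eq` — `ℂ_p` has enough roots of unity); (c) for each
such character `χ`, `∫ χ(σ̄)·𝟙[ρ(σ)⁻¹ ≡ ρ(g)⁻¹ mod p^{n+1}] dν = 0` by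
`integral_mul_cellInd_inv_eq_zero_of_forall_moment` (push-forward along `ρ⁻¹` + the units brick); summing,
`ν(gU_n) = 0`.

MODEL (cell `bsd-print-cf2`, director-bsd 2026-08-30 OPTION 1 / planner (T4), LEAD card
`Cruxes/KatzDistributionsAtTwoPrint/Lines/katz_measure_two.md` v2.2 «(T4a) brick 2»): `G = Gal(K̄/K(𝔪₀))`,
`U_n = Gal(K̄/K(𝔪_n v^{n+1}))`, `ρ = e₂ ∘ κ_v` (de Shalit's `v`-adic character, I.3.3 (9) / II.1.7), `I` the inertia
group at `v`, `ν = μ − μ′` for two solutions of the `(m, 0)`-identities of II Thm. 4.14 with the same periods —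
the remaining inputs there are the range supply (`φ₀^m·χ` in range) and the exact avatar identity
`φ̂₀ = (e₂κ_v)⁻¹` on `G` (lane piece A2).

References: [deShalit1987] E. de Shalit, *Iwasawa theory of elliptic curves with complex multiplication* (1987),
I.3.1–3.4 (p. 15–18), II.4.12 Remark (iv) (p. 67: uniqueness of `μ`); [Washington1997] L. C. Washington,
*Introduction to Cyclotomic Fields*, §7.2, §12.2; [SerreLinearRepresentations1977] J.-P. Serre, *Linear
Representations of Finite Groups*, §2.4, §3.1.
-/

noncomputable section

open Filter Topology
open scoped Classical Pointwise

namespace Literature.NumberTheory.EllipticCurves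

namespace GroupDistribution

variable {G : Type*} [Group G] {𝒰 : SubgroupTower G} [∀ n, (𝒰.U n).Normal]
variable {p : ℕ} [Fact p.Prime]

/-! ### §1. Algebraic preliminaries -/

omit [∀ n, (𝒰.U n).Normal] in
/-- Reduction `mod pⁿ` of a congruence `mod p^{n+1}`. [cite: Washington1997, §7.2] -/
theorem toZModPow_eq_one_of_succ (ρ : G →* ℤ_[p]ˣ)
    (hρU : ∀ (n : ℕ) (σ : G), σ ∈ 𝒰.U n → PadicInt.toZModPow (n + 1) ((ρ σ : ℤ_[p]ˣ) : ℤ_[p]) = 1)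
    (n : ℕ) (σ : G) (hσ : σ ∈ 𝒰.U n) : PadicInt.toZModPow n ((ρ σ : ℤ_[p]ˣ) : ℤ_[p]) = 1 := by
  rw [← PadicInt.cast_toZModPow n (n + 1) n.le_succ, hρU n σ hσ, ZMod.cast_one (pow_dvd_pow p n.le_succ)]

/-- Units with congruent inverses are congruent. [cite: Washington1997, §7.2] -/
theorem toZModPow_eq_of_inv_eq (k : ℕ) {u v : ℤ_[p]ˣ}
    (h : PadicInt.toZModPow k ((u⁻¹ : ℤ_[p]ˣ) : ℤ_[p]) = PadicInt.toZModPow k ((v⁻¹ : ℤ_[p]ˣ) : ℤ_[p])) :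
    PadicInt.toZModPow k (u : ℤ_[p]) = PadicInt.toZModPow k (v : ℤ_[p]) := by
  have hu : PadicInt.toZModPow k (u : ℤ_[p]) * PadicInt.toZModPow k ((u⁻¹ : ℤ_[p]ˣ) : ℤ_[p]) = 1 := by
    rw [← map_mul, Units.mul_inv, map_one]
  have hv : PadicInt.toZModPow k ((v⁻¹ : ℤ_[p]ˣ) : ℤ_[p]) * PadicInt.toZModPow k (v : ℤ_[p]) = 1 := by
    rw [← map_mul, Units.inv_mul, map_one]
  calc PadicInt.toZModPow k (u : ℤ_[p])
      = PadicInt.toZModPow k (u : ℤ_[p]) * (PadicInt.toZModPow k ((v⁻¹ : ℤ_[p]ˣ) : ℤ_[p]) *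
          PadicInt.toZModPow k (v : ℤ_[p])) := by rw [hv, mul_one]
    _ = (PadicInt.toZModPow k (u : ℤ_[p]) * PadicInt.toZModPow k ((u⁻¹ : ℤ_[p]ˣ) : ℤ_[p])) *
          PadicInt.toZModPow k (v : ℤ_[p]) := by rw [← h, mul_assoc]
    _ = PadicInt.toZModPow k (v : ℤ_[p]) := by rw [hu, one_mul]

/-- A character of a finite group with values in `ℂ_p` has values of norm `1` (`χ(q)^{|Q|} = 1`).
[cite: SerreLinearRepresentations1977, §3.1] -/
theorem norm_apply_monoidHom_eq_one {Q : Type*} [Group Q] [Finite Q] (χ : Q →* ℂ_[p]) (q : Q) :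
    ‖χ q‖ = 1 := by
  have hpow : χ q ^ Nat.card Q = 1 := by rw [← map_pow, pow_card_eq_one', map_one]
  have hn : ‖χ q‖ ^ Nat.card Q = 1 := by rw [← norm_pow, hpow, norm_one]
  exact (pow_eq_one_iff_of_nonneg (norm_nonneg _) Nat.card_pos.ne').mp hn

/-! ### §2. The uniqueness theorem -/

/-- ★★★ **A GROUP DISTRIBUTION KILLED BY EVERY `χ·(ρ⁻¹)^m`, `m ≥ m₀`, IS ZERO.** With `G`, `𝒰` (normal levels,
abelian quotients `hcomm`), `ρ : G →* ℤ_pˣ` (`ρ ≡ 1 mod p^{n+1}` on `U_n`), `I ≤ G` separated by `ρ` along the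
tower (`hI`), and `ν` on `G` along `𝒰` with `∫ χ·(ρ⁻¹)^m dν = 0` for every `m ≥ m₀` and every character
`χ : G →* ℂ_p` trivial on some `U_N` and on `I`: every level datum `ν.μ n a` vanishes.
[cite: deShalit1987, II.4.12 Remark (iv) (p. 67), I.3.1–3.4 (p. 15–18)] [cite: Washington1997, §7.2]
[cite: SerreLinearRepresentations1977, §2.4 and §3.1] -/
theorem μ_eq_zero_of_forall_integral_char_mul_inv_pow (ν : GroupDistribution 𝒰 ℂ_[p]) (ρ : G →* ℤ_[p]ˣ)
    (I : Subgroup G)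
    (hcomm : ∀ (n : ℕ) (x y : G), x * y * x⁻¹ * y⁻¹ ∈ 𝒰.U n)
    (hρU : ∀ (n : ℕ) (σ : G), σ ∈ 𝒰.U n → PadicInt.toZModPow (n + 1) ((ρ σ : ℤ_[p]ˣ) : ℤ_[p]) = 1)
    (hI : ∀ (n : ℕ) (i : G), i ∈ I → PadicInt.toZModPow (n + 1) ((ρ i : ℤ_[p]ˣ) : ℤ_[p]) = 1 → i ∈ 𝒰.U n)
    (m₀ : ℕ)
    (hν : ∀ (N : ℕ) (χ : G →* ℂ_[p]), (∀ u ∈ 𝒰.U N, χ u = 1) → (∀ i ∈ I, χ i = 1) →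
      ∀ m : ℕ, m₀ ≤ m →
        ν.integral (fun σ ↦ χ σ * padicIntCast ℂ_[p] (((ρ σ)⁻¹ : ℤ_[p]ˣ) : ℤ_[p]) ^ m) = 0)
    (n : ℕ) (a : G ⧸ 𝒰.U n) : ν.μ n a = 0 := by
  haveI : (𝒰.U n).FiniteIndex := 𝒰.finiteIndex n
  -- a representative of the cell
  obtain ⟨g, rfl⟩ : ∃ g : G, 𝒰.proj n g = a := ⟨𝒰.repr n a, 𝒰.proj_repr n a⟩
  -- the subgroup `N = U_n ⊔ I`, normal with finite abelian quotient `Q`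
  let N : Subgroup G := 𝒰.U n ⊔ I
  have hUN : 𝒰.U n ≤ N := le_sup_left
  have hIN : I ≤ N := le_sup_right
  haveI hNn : N.Normal := ⟨fun m hm x ↦ by
    have hx : x * m * x⁻¹ = (x * m * x⁻¹ * m⁻¹) * m := by group
    rw [hx]
    exact N.mul_mem (hUN (hcomm n x m)) hm⟩
  haveI : N.FiniteIndex := Subgroup.finiteIndex_of_le hUN
  let Q := G ⧸ N
  haveI : Finite Q := Subgroup.finite_quotient_of_finiteIndex
  have hQcomm : ∀ x y : Q, x * y = y * x := by
    intro x y
    induction x using QuotientGroup.induction_on with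
    | H x =>
      induction y using QuotientGroup.induction_on with
      | H y =>
        rw [← QuotientGroup.mk_mul, ← QuotientGroup.mk_mul, QuotientGroup.eq]
        have hc := hUN (hcomm n y⁻¹ x⁻¹)
        rw [inv_inv, inv_inv] at hc
        simpa [mul_inv_rev, mul_assoc] using hc
  letI : CommGroup Q := { (inferInstance : Group Q) with mul_comm := hQcomm }
  -- the Fourier expansion of the indicator of `ḡ` on `Q`
  haveI : NeZero (Monoid.exponent Q) := ⟨Monoid.exponent_ne_zero_of_finite⟩
  haveI : HasEnoughRootsOfUnity ℂ_[p] (Monoid.exponent Q) :=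
    Literature.GroupTheory.Abelian.CharacterSpan.hasEnoughRootsOfUnity_padicComplex p _
  haveI : Finite (Q →* ℂ_[p]) := Literature.GroupTheory.Abelian.CharacterSpan.finite_monoidHom Q ℂ_[p]
  haveI : Fintype (Q →* ℂ_[p]) := Fintype.ofFinite _
  obtain ⟨c, hc⟩ := Literature.GroupTheory.Abelian.CharacterSpan.exists_sum_smul_monoidHom_padicComplex_eq p Q
    (fun q : Q ↦ if q = ((g : G) : Q) then (1 : ℂ_[p]) else 0)
  have hF : ∀ σ : G, ∑ χ : Q →* ℂ_[p], c χ * χ ((σ : G) : Q) =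
      (if ((σ : G) : Q) = ((g : G) : Q) then (1 : ℂ_[p]) else 0) := fun σ ↦ by
    have h := congr_fun hc ((σ : G) : Q)
    simpa only [Finset.sum_apply, Pi.smul_apply, smul_eq_mul] using h
  -- the congruence indicator `w σ = 𝟙[ρ(σ)⁻¹ ≡ ρ(g)⁻¹ mod p^{n+1}]`
  let Φ : G → ℤ_[p] := fun σ ↦ (((ρ σ)⁻¹ : ℤ_[p]ˣ) : ℤ_[p])
  let a₀ : ZMod (p ^ (n + 1)) := PadicInt.toZModPow (n + 1) (Φ g)
  let w : G → ℂ_[p] := fun σ ↦ cellInd (𝕜 := ℂ_[p]) (n + 1) a₀ (Φ σ)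
  -- (a) the cell identity: `𝟙_{gU_n} = 𝟙_{gN} · w`
  have hcell : ∀ σ : G, (if 𝒰.proj n σ = 𝒰.proj n g then (1 : ℂ_[p]) else 0) =
      (if ((σ : G) : Q) = ((g : G) : Q) then (1 : ℂ_[p]) else 0) * w σ := by
    intro σ
    by_cases hσ : 𝒰.proj n σ = 𝒰.proj n g
    · -- inside the cell: `σ ∈ gN` and the congruence holds
      have hgσ : g⁻¹ * σ ∈ 𝒰.U n := 𝒰.proj_eq_iff.mp hσ.symm
      have hQ : ((σ : G) : Q) = ((g : G) : Q) := by
        rw [eq_comm, QuotientGroup.eq]; exact hUN hgσ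
      have hw : w σ = 1 := by
        change cellInd (𝕜 := ℂ_[p]) (n + 1) a₀ (Φ σ) = 1
        rw [cellInd_apply, if_pos]
        exact (toZModPow_inv_eq_of_proj_eq ρ (hρU n) hσ.symm).symm ▸ rfl
      rw [if_pos hσ, if_pos hQ, hw, mul_one]
    · rw [if_neg hσ]
      by_cases hQ : ((σ : G) : Q) = ((g : G) : Q)
      · -- `σ ∈ gN` but not in `gU_n`: the congruence fails
        rw [if_pos hQ, one_mul]
        change 0 = cellInd (𝕜 := ℂ_[p]) (n + 1) a₀ (Φ σ)
        rw [cellInd_apply, if_neg]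
        intro hcong
        apply hσ
        -- from the congruence: `ρ(g⁻¹σ) ≡ 1`; write `g⁻¹σ = u·i`, deduce `i ∈ U_n`
        have hmem : g⁻¹ * σ ∈ N := by
          have := (QuotientGroup.eq (s := N)).mp hQ.symm
          exact this
        have hset : (g⁻¹ * σ) ∈ ((𝒰.U n : Set G) * (I : Set G)) := by
          rw [← Subgroup.normal_mul]; exact hmem
        obtain ⟨u, hu, i, hi, hui⟩ := Set.mem_mul.mp hset
        have hρσ : PadicInt.toZModPow (n + 1) ((ρ σ : ℤ_[p]ˣ) : ℤ_[p]) =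
            PadicInt.toZModPow (n + 1) ((ρ g : ℤ_[p]ˣ) : ℤ_[p]) := toZModPow_eq_of_inv_eq (n + 1) hcong
        have hρi : PadicInt.toZModPow (n + 1) ((ρ i : ℤ_[p]ˣ) : ℤ_[p]) = 1 := by
          have h1 : PadicInt.toZModPow (n + 1) ((ρ (g⁻¹ * σ) : ℤ_[p]ˣ) : ℤ_[p]) = 1 := by
            have hprod : PadicInt.toZModPow (n + 1) (((ρ g)⁻¹ : ℤ_[p]ˣ) : ℤ_[p]) *
                PadicInt.toZModPow (n + 1) ((ρ g : ℤ_[p]ˣ) : ℤ_[p]) = 1 := by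
              rw [← map_mul, Units.inv_mul, map_one]
            rw [map_mul, map_inv, Units.val_mul, map_mul, hρσ, hprod]
          rw [← hui, map_mul, Units.val_mul, map_mul, hρU n u hu, one_mul] at h1
          exact h1
        have hiU : i ∈ 𝒰.U n := hI n i hi hρi
        have hgσU : g⁻¹ * σ ∈ 𝒰.U n := by rw [← hui]; exact (𝒰.U n).mul_mem hu hiU
        exact (𝒰.proj_eq_iff.mpr hgσU).symm
      · rw [if_neg hQ, zero_mul]
  -- tower continuity of the characters of `Q` pulled back to `G`, and of `w`
  have hχc : ∀ χ : Q →* ℂ_[p], 𝒰.IsTowerContinuous (fun σ : G ↦ χ ((σ : G) : Q)) := fun χ ↦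
    SubgroupTower.IsTowerContinuous.of_exists fun ε hε ↦ ⟨n, fun σ τ h ↦ by
      have hQ : ((σ : G) : Q) = ((τ : G) : Q) := by
        rw [QuotientGroup.eq]; exact hUN (𝒰.proj_eq_iff.mp h)
      rw [hQ, dist_self]; exact hε⟩
  have hwc : 𝒰.IsTowerContinuous w :=
    SubgroupTower.IsTowerContinuous.of_exists fun ε hε ↦ ⟨n, fun σ τ h ↦ by
      change dist (cellInd (𝕜 := ℂ_[p]) (n + 1) a₀ (Φ σ)) (cellInd (𝕜 := ℂ_[p]) (n + 1) a₀ (Φ τ)) < ε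
      rw [cellInd_apply, cellInd_apply, toZModPow_inv_eq_of_proj_eq ρ (hρU n) h, dist_self]; exact hε⟩
  have hw1 : ∀ σ, ‖w σ‖ ≤ 1 := fun σ ↦ norm_cellInd_le (n + 1) a₀ _
  -- (c) each character term vanishes: push-forward along `ρ⁻¹` + the units brick
  have hterm : ∀ χ : Q →* ℂ_[p], ν.integral (fun σ ↦ χ ((σ : G) : Q) * w σ) = 0 := by
    intro χ
    have ha₀ : IsUnit a₀ := (Units.isUnit (ρ g)⁻¹).map _
    refine integral_mul_cellInd_inv_eq_zero_of_forall_moment ν ρ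
      (fun k σ hσ ↦ toZModPow_eq_one_of_succ ρ hρU k σ hσ) (hχc χ) zero_le_one
      (fun σ ↦ (norm_apply_monoidHom_eq_one χ _).le) m₀ (fun m hm ↦ ?_) (Nat.succ_le_succ (Nat.zero_le n)) ha₀
    -- the moment hypothesis for the pulled-back character `χ ∘ mk`
    have h := hν n (χ.comp (QuotientGroup.mk' N)) (fun u hu ↦ by
        rw [MonoidHom.comp_apply, QuotientGroup.mk'_apply, (QuotientGroup.eq_one_iff u).mpr (hUN hu), map_one])
      (fun i hi ↦ by
        rw [MonoidHom.comp_apply, QuotientGroup.mk'_apply, (QuotientGroup.eq_one_iff i).mpr (hIN hi), map_one])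
      m hm
    exact h
  -- assemble: `ν(gU_n) = ∫ 𝟙_{gU_n} = Σ_χ c_χ ∫ χ·w = 0`
  rw [← ν.integral_indicator_cell n (𝒰.proj n g)]
  have hfun : (fun σ : G ↦ (if 𝒰.proj n σ = 𝒰.proj n g then (1 : ℂ_[p]) else 0)) =
      fun σ ↦ ∑ χ : Q →* ℂ_[p], c χ * (χ ((σ : G) : Q) * w σ) := by
    funext σ
    rw [hcell σ, ← hF σ, Finset.sum_mul]
    refine Finset.sum_congr rfl fun χ _ ↦ ?_
    ring
  have htc : ∀ χ : Q →* ℂ_[p], 𝒰.IsTowerContinuous (fun σ : G ↦ χ ((σ : G) : Q) * w σ) := fun χ ↦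
    (hχc χ).mul hwc (M := 1) (fun σ ↦ (norm_apply_monoidHom_eq_one χ _).le) hw1
  rw [hfun, ν.integral_finset_sum _ (f := fun χ σ ↦ c χ * (χ ((σ : G) : Q) * w σ))
    (fun χ _ ↦ (htc χ).const_mul (c χ))]
  refine Finset.sum_eq_zero fun χ _ ↦ ?_
  rw [ν.integral_const_mul (c χ) (htc χ), hterm χ, mul_zero]

end GroupDistribution

end Literature.NumberTheory.EllipticCurves

end
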